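import Literature.AlgebraicGeometry.Deformation.T1LiftingAuxiliaryAlgebras
import Literature.AlgebraicGeometry.Deformation.CurvilinearSmoothness
import HarnessLib

/-!
# [FM99] Lemma 0.3 (first clause) and Theorem A′ for the functor of points of `R = k[[x_1, …, x_n]]/I`, unconditionally

[FantechiManetti1999T1Lifting] (B. Fantechi, M. Manetti, *On the T¹-lifting theorem*, J. Algebraic Geom. 8 (1999) 31–39;
authors' version), §0 (p. 2): «For such an `R`, define `h_R(A) = Hom(R, A)`. Let `T²_R` be the vector space
`Ex(R, k)`; `T²_R` can be computed as `(I/𝔪I)^∨`, where `R = P/I`, `P = k[[x_1, …, x_n]]`, and `I` is an ideal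
contained in `𝔪²_P`.» and LEMMA 0.3: «`T²_R` is naturally an obstruction space for `h_R`; every other obstruction
space contains `T²_R` canonically as a vector subspace.», whose proof («see e.g. [FM1] §5») uses the lifting step of
[FantechiManetti1998ObstructionCalculus, Lemma 5.2 (ii), proof]: «Such a lifting always exists, because to give a
local morphism from `P = k[[x_1, …, x_n]]` to `S ∈ Art_k` is equivalent to choosing `f_1, …, f_n ∈ 𝔪_S`»; THEOREM A′ (p. 5): «Let `F` be a functor of Artin rings, and assume that `F` satisfies (H1) and (H2), has an
obstruction space `T²_F` and the T¹-lifting property. If char `k = 0` then `F(A_{m+1}) → F(A_m)` is surjective for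
every `m ≥ 1`.»; and p. 1: «In [Kaw1] Kawamata … proved theorem A under the additional assumption that
`F` be prorepresentable».

The tree's `ArtinFunctor.powerSeriesPointsObstructionSpace` and `ArtinFunctor.powerSeriesPoints_map_i_surjective_of_t1Lifting`
(`T1LiftingAuxiliaryAlgebras.lean`) take the lifting property of `h_P`, `P = k[[x_1, …, x_n]]`, as an ARGUMENT `hP`,
because the module proving it (`CurvilinearSmoothness.lean`, `points_mvPowerSeries_map_surjective` =
[Schlessinger1968, Prop. 2.5 (i)]) could not be imported the night that file landed. This file imports both and records
the `hP`-free forms: (1) `T²_R = (I/𝔪I)^∨` IS an obstruction space of `h_R` for EVERY `I ⊆ 𝔪²_P`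
(`ArtinFunctor.powerSeriesPointsObstructionSpace'`); (2) Theorem A′ applied to `h_R`: in characteristic zero,
T¹-lifting gives `h_R(A_{m+1}) → h_R(A_m)` onto for every `m ≥ 1` (`powerSeriesPoints_map_i_surjective_of_t1Lifting'`);
(3) REMARK (no declaration): feeding (2) to [FantechiManetti1998ObstructionCalculus, Lemma 5.6] (iii) ⇒ (i)
(`powerSeries_ideal_eq_bot_of_points_map_i_surjective k I hI 1 …`, tree index `N₀ = 1` = printed `N₀ = 2`) gives `I = 0` —
Kawamata's T¹-lifting theorem for pro-representable functors through Theorem A′, the (H1)+(H2)+obstruction-space road of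
[FM99] (p. 5: «Theorem A′ implies in fact that such an `F` is unobstructed», Remark 1.2: the case `m = 1` «is not needed
to ensure smoothness, as in [FM1], lemma 5.6»); that conclusion is ALREADY the tree theorem
`powerSeries_ideal_eq_bot_of_t1Lifting` (`CurvilinearSmoothness.lean`, reached through (H4)), so it is cited here and
not re-declared. No new definition beyond the `hP`-free abbreviation; no named fact, no sorry.

## References

* B. Fantechi, M. Manetti, *On the T¹-lifting theorem*, J. Algebraic Geom. 8 (1999) 31–39: Lemma 0.3, Theorem A′, p. 1.
  [FantechiManetti1999T1Lifting]
* B. Fantechi, M. Manetti, *Obstruction calculus for functors of Artin rings, I*, J. Algebra 202 (1998) 541–576: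
  Lemma 5.2, Prop. 5.3 (i), Lemma 5.6. [FantechiManetti1998ObstructionCalculus]
* M. Schlessinger, *Functors of Artin rings*, Trans. AMS 130 (1968) 208–222: Prop. 2.5 (i). [Schlessinger1968]
* Y. Kawamata, *Unobstructed deformations — a remark on a paper of Z. Ran*, J. Algebraic Geom. 1 (1992) 183–190.
  [Kawamata1992UnobstructedDeformations]
-/

noncomputable section

universe u

namespace Literature.AlgebraicGeometry.Deformation

variable (k : Type u) [Field k]

/-- **[FantechiManetti1999T1Lifting, Lemma 0.3], first clause, for `R = k[[x_1, …, x_n]]/I`, `I ⊆ 𝔪²_P`, UNCONDITIONALLY**: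
`T²_R = (I/𝔪_P I)^∨` is an obstruction space (Def. 0.1) for the functor of points `h_R` — the tree's
`ArtinFunctor.powerSeriesPointsObstructionSpace` with its lifting argument `hP` («Such a lifting always exists») supplied
by `points_mvPowerSeries_map_surjective` ([Schlessinger1968, Prop. 2.5 (i)]). [cite: FantechiManetti1999T1Lifting, Lemma 0.3]
[cite: FantechiManetti1998ObstructionCalculus, Lemma 5.2] [cite: Schlessinger1968, Prop. 2.5 (i)] -/
def ArtinFunctor.powerSeriesPointsObstructionSpace' {n : ℕ} (I : Ideal (MvPowerSeries (Fin n) k))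
    (hI : I ≤ (IsLocalRing.maximalIdeal (MvPowerSeries (Fin n) k)) ^ 2) :
    (ArtinFunctor.points (k := k) (MvPowerSeries (Fin n) k ⧸ I)).ObstructionSpace
      (Module.Dual k (ProRep.IModMI k (IsLocalRing.maximalIdeal (MvPowerSeries (Fin n) k)) I)) :=
  ArtinFunctor.powerSeriesPointsObstructionSpace k (fun _ _ p hp => points_mvPowerSeries_map_surjective k p hp) I hI

/-- **[FantechiManetti1999T1Lifting, Theorem A′] APPLIED to `h_R`, `R = k[[x_1, …, x_n]]/I`, `I ⊆ 𝔪²_P`, UNCONDITIONALLY**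
(«In [Kaw1] Kawamata … proved theorem A under the additional assumption that `F` be prorepresentable», p. 1): in
characteristic zero, if `h_R` has the T¹-lifting property then `h_R(A_{m+1}) → h_R(A_m)` is surjective for every
`m ≥ 1` — `h_R` satisfies (H1), (H2) (indeed (H4): [FantechiManetti1998ObstructionCalculus, Prop. 5.3 (i)], p. 560,
«`h_R` is left-exact, in particular satisfies (H1), …, (H4)»; the tree's `ArtinFunctor.points_H4`), `h_R(k) = {pt}` since
`R` is local with residue field `k` ([FantechiManetti1999T1Lifting, p. 1] «`F(k) = {pt}`»), and `h_R` has the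
obstruction space `(I/𝔪I)^∨` above. With [FantechiManetti1998ObstructionCalculus, Lemma 5.6] this yields `I = 0`: the
tree's `powerSeries_ideal_eq_bot_of_t1Lifting` (not re-declared here).
[cite: FantechiManetti1999T1Lifting, Theorem A′ and Lemma 0.3] [cite: FantechiManetti1998ObstructionCalculus, Prop. 5.3 (i)] -/
theorem ArtinFunctor.powerSeriesPoints_map_i_surjective_of_t1Lifting' [CharZero k] {n : ℕ}
    (I : Ideal (MvPowerSeries (Fin n) k)) (hI : I ≤ (IsLocalRing.maximalIdeal (MvPowerSeries (Fin n) k)) ^ 2)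
    (hT : (ArtinFunctor.points (k := k) (MvPowerSeries (Fin n) k ⧸ I)).T1Lifting) (m : ℕ) (hm : 1 ≤ m) :
    Function.Surjective ((ArtinFunctor.points (k := k) (MvPowerSeries (Fin n) k ⧸ I)).map
      (R := T1Lifting.artA k (m + 1)) (S := T1Lifting.artA k m) (T1Lifting.i k m)) :=
  ArtinFunctor.powerSeriesPoints_map_i_surjective_of_t1Lifting k
    (fun _ _ p hp => points_mvPowerSeries_map_surjective k p hp) I hI hT m hm

end Literature.AlgebraicGeometry.Deformation
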